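import Summits.BirchSwinnertonDyer.BirchSwinnertonDyer.Theorems.ConjSpanGenAllLevels
import Summits.BirchSwinnertonDyer.BirchSwinnertonDyer.Theorems.PrintX8VerticalStevensIrreducible
import Summits.BirchSwinnertonDyer.BirchSwinnertonDyer.Theorems.PrintX10bAnalyticMuZeroX10bStubUnitMeasureOfNonconstancy
import Summits.BirchSwinnertonDyer.BirchSwinnertonDyer.Theorems.Rank1ResidualX9MuTransfer
import Literature.NumberTheory.EllipticCurves.PAdicLFunctionBranchMuCertificateProofs
import HarnessLib

/-!
# Route PrintX9, crux 19630 `AnalyticMuZeroX9` — PARTIAL, image-free, class-wide: modulo the two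
# printed theorems (L) ∧ (C), SOME EVEN tame branch `L_p(E, ω^i)` of every X9 pair has `μ = 0`
# (bsd-f3-mu candidate AN-13, composed over tree names)

Cell `bsd-print-x9` (D-0131 (2) print tier), seat p2 («`μ = 0` by congruence transport + analytic `μ = 0`
certificate»), gen 3. HONEST FRAMING: theorems only, no definition, no named fact, no `sorry`;
`--supports stmt-BirchSwinnertonDyer-19630 --as helper`; NOTHING IS BOOKED. The crux 19630 asks for
`μ(L_p(E, ω⁰)) = 0` (the `p`-adic `L`-function itself); the theorem below reaches only «`μ(L_p(E, ω^i)) = 0`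
for SOME EVEN `i`» — at `p = 5`: `μ(L_5(E)) = 0 ∨ μ(L_5(E, ω²)) = 0` — which is the exact residue of the
unit-residue / winding-span method at `p ≥ 5` (bsd-f3-mu MEMO-an §10.4 «honest ceiling», barrier note
B-an-5; at `p = 3` the only even branch is `ω⁰`, which is why LINE `theoremB-x10b` closes crux 20682).
The statement «some even branch» for every `E/ℚ` at every odd good ordinary `p` with `E[p]` irreducible
is bsd-f3-mu's candidate **AN-13** (`-an` g5, `EvenBranch.lean` d2d3e89f182638d5, MEMO-an §14.10, with an
end-to-end kernel file in their HOME); this file is the COMPOSITION over TREE declarations only: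

  (L) ∧ (C) ⟹ THEOREM B `ConjSpanGenAll` (`ConjSpanGenAllLevels.conjSpanGenAll_of_morris_of_serre`,
  cells bsd-f3-mu `-an` / bsd-print-x8) ⟹ AN-9 `CycWindingNonConstantAt W p` for odd good `p`, `E[p]`
  irreducible (`PrintX8VerticalStevens.cycWindingNonConstancyOddIrreducible_of_conjSpanGenAll`, bsd-print-x8
  p1) ⟹ a unit value of the Mazur–Swinnerton-Dyer measure at a unit residue
  (`Theorems.CollapseThree.exists_isUnit_one_le_norm_msdMeasure_of_cycWindingNonConstantAt`, bsd-f3-mu `-an`,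
  LINE B stub 3a file) ⟹ a unit coefficient of some EVEN branch
  (`exists_even_branch_norm_coeff_eq_one_of_unit_msdMeasure_of_isNewformOf`,
  `Literature/…/PAdicLFunctionBranchMuCertificateProofs`, this seat: orthogonality over `μ_{p−1}(ℤ_p)` +
  the branch certificate + evenness of the plus measure).

Hypotheses displayed verbatim: (L) `Morris2007.thm61_2_elementary_boundedlyGenerates` (Morris, New York J.
Math. 13 (2007) Thm. 6.1(2)) and (C) `SerreSL2Congruence1970_congruenceSubgroupProperty_away` (Serre, Ann. of
Math. 92 (1970) §2.6) — cite-only Literature facts, the inputs of THEOREM B (bsd-f3-mu W-43 variant B).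

* `evenBranchMuZero_of_conjSpanGenAll` — THEOREM B ⟹ AN-13 (all odd good ordinary `p`, `E[p]` irreducible);
* `evenBranchMuZero_of_morris_of_serre` — (L) → (C) → AN-13;
* `evenBranchMuZeroOnClassX9_of_morris_of_serre` — (L) → (C) → for every X9 pair `(W, p)`
  (`Rank1Residual.ClassX9`: `p ≥ 5` good ordinary, `E[p]` irreducible, not surjective) and every newform
  `f` of `W`: `∃ i < p − 1, Even i ∧ ∃ k, ‖[Tᵏ] L_p(f, α_W, ω^i, T)‖ = 1`.

beyond-print theorem: the composed statement AN-13 is bsd-f3-mu's yes-candidate (placement by their ref2;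
nearest print GV2000 §3 / EPW06 §3 / Sun 2007 Conj. 8) — PARTIAL toward the leaf, NOT the crux, not
booked; this seat's own files are folklore made kernel. References: [MazurTateTeitelbaum1986Invent] §I.13;
[GreenbergVatsal2000] §3; [Morris2007]; [SerreSL2Congruence1970]; bsd-f3-mu MEMO-an §10.3–10.4, §13, §14.10.
-/

-- the summit and its single problem are both named `BirchSwinnertonDyer` (registry layout D-0017)
set_option linter.dupNamespace false

noncomputable section

open scoped Classical MatrixGroups ModularForm

open CongruenceSubgroup WeierstrassCurve Literature.NumberTheory.EllipticCurves
  Literature.NumberTheory.EllipticCurves.ModularForms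
  Literature.NumberTheory.EllipticCurves.Rank1Residual
  Summit.BirchSwinnertonDyer.BirchSwinnertonDyer.Theorems

namespace Summit.BirchSwinnertonDyer.BirchSwinnertonDyer.Rank1Residual.EvenBranch

/-- **THEOREM B ⟹ AN-13.** If the cyclotomic winding classes span `pr Γ_H(N)` at every level and every
prime `p ∤ N` (`ConjSpanGenAll`, THEOREM B of cell bsd-f3-mu), then for every `E = W/ℚ`, every ODD good
ordinary `p` with `E[p]` irreducible and every newform `f` of `E`, SOME EVEN tame branch
`L_p(f, α_E, ω^i, T)`, `i < p − 1`, has a `p`-adic unit coefficient (`μ = 0`). Composition of AN-9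
(`cycWindingNonConstancyOddIrreducible_of_conjSpanGenAll`), the modular-symbol half of the collapse
(`CollapseThree.exists_isUnit_one_le_norm_msdMeasure_of_cycWindingNonConstantAt`) and the even-branch
certificate (`exists_even_branch_norm_coeff_eq_one_of_unit_msdMeasure_of_isNewformOf`).
[cite: MazurTateTeitelbaum1986Invent, §I.13] [cite: GreenbergVatsal2000, §3 Prop. (3.7)] -/
theorem evenBranchMuZero_of_conjSpanGenAll (hB : ConjSpanGenAllLevels.ConjSpanGenAll) :
    ∀ (W : WeierstrassCurve ℚ) [W.IsElliptic] [W.IsGloballyMinimal] (p : ℕ) [Fact p.Prime],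
      p ≠ 2 → IsOrdinaryAt W p → W.HasIrreducibleModPGaloisRep p →
      ∀ {N : ℕ} [NeZero N] (f : CuspForm (Gamma0 N) 2), IsNewformOf W f →
        ∃ i < p - 1, Even i ∧
          ∃ k : ℕ, ‖PowerSeries.coeff k (padicLFunctionBranch f (unitRoot W p : ℚ_[p]) i)‖ = 1 := by
  intro W _ _ p _ hp2 hord hirr N _ f hf
  have hnc : CycWindingNonConstantAt W p :=
    PrintX8VerticalStevens.cycWindingNonConstancyOddIrreducible_of_conjSpanGenAll
      (fun M q _ hq hqM ↦ hB M q hq hqM) W p hp2 hord.1 hirr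
  obtain ⟨n, b, hbu, hb1⟩ :=
    CollapseThree.exists_isUnit_one_le_norm_msdMeasure_of_cycWindingNonConstantAt hp2 W f hord hf hirr hnc
  exact exists_even_branch_norm_coeff_eq_one_of_unit_msdMeasure_of_isNewformOf hp2 hord hf hirr hbu hb1

/-- **(L) ∧ (C) ⟹ AN-13**: modulo Morris 2007 Thm. 6.1(2) (`hL`) and Serre 1970 §2.6 (`hC`) — the two
cite-only inputs of THEOREM B (`ConjSpanGenAllLevels.conjSpanGenAll_of_morris_of_serre`) — every ODD good
ordinary `p` with `E[p]` irreducible has an EVEN branch `L_p(f, α_E, ω^i)` with `μ = 0`, for every newform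
`f` of `E`. [cite: Morris2007, Thm. 6.1(2)] [cite: SerreSL2Congruence1970, §2.6 Cor. 3] -/
theorem evenBranchMuZero_of_morris_of_serre
    (hL : Literature.GroupTheory.ArithmeticGroups.Morris2007.thm61_2_elementary_boundedlyGenerates)
    (hC : Literature.NumberTheory.Automorphic.SerreSL2Congruence1970_congruenceSubgroupProperty_away) :
    ∀ (W : WeierstrassCurve ℚ) [W.IsElliptic] [W.IsGloballyMinimal] (p : ℕ) [Fact p.Prime],
      p ≠ 2 → IsOrdinaryAt W p → W.HasIrreducibleModPGaloisRep p →
      ∀ {N : ℕ} [NeZero N] (f : CuspForm (Gamma0 N) 2), IsNewformOf W f →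
        ∃ i < p - 1, Even i ∧
          ∃ k : ℕ, ‖PowerSeries.coeff k (padicLFunctionBranch f (unitRoot W p : ℚ_[p]) i)‖ = 1 :=
  evenBranchMuZero_of_conjSpanGenAll (ConjSpanGenAllLevels.conjSpanGenAll_of_morris_of_serre hL hC)

/-- **AN-13 on class X9, modulo (L) ∧ (C)** (route PrintX9, crux 19630 — PARTIAL): for every X9 pair `(W, p)`
(`Rank1Residual.ClassX9`: non-CM, `p ≥ 5` good ordinary, `E[p]` irreducible, `ρ̄_{E,p}` NOT surjective) and
every newform `f` of `W`, SOME EVEN tame branch `L_p(f, α_W, ω^i, T)`, `i < p − 1`, has a `p`-adic unit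
coefficient: at `p = 5`, `μ(L_5(E)) = 0 ∨ μ(L_5(E, ω²)) = 0`; at `p = 7`, one of the branches `ω⁰, ω², ω⁴`.
Image-free (irreducibility is used only as «non-Eisenstein»). NOT the crux (`ω⁰` alone is item 19630).
[cite: Morris2007, Thm. 6.1(2)] [cite: SerreSL2Congruence1970, §2.6 Cor. 3] [cite: GreenbergLNM1716, §1 Conj. 1.11] -/
theorem evenBranchMuZeroOnClassX9_of_morris_of_serre
    (hL : Literature.GroupTheory.ArithmeticGroups.Morris2007.thm61_2_elementary_boundedlyGenerates)
    (hC : Literature.NumberTheory.Automorphic.SerreSL2Congruence1970_congruenceSubgroupProperty_away) :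
    ∀ (W : WeierstrassCurve ℚ) [W.IsElliptic] [W.IsGloballyMinimal] (p : ℕ) [Fact p.Prime],
      ClassX9 W p →
      ∀ {N : ℕ} [NeZero N] (f : CuspForm (Gamma0 N) 2), IsNewformOf W f →
        ∃ i < p - 1, Even i ∧
          ∃ k : ℕ, ‖PowerSeries.coeff k (padicLFunctionBranch f (unitRoot W p : ℚ_[p]) i)‖ = 1 := by
  intro W _ _ p _ hX9 N _ f hf
  obtain ⟨-, hp, hgood, hord, hirr, -⟩ := id hX9
  exact evenBranchMuZero_of_morris_of_serre hL hC W p (by omega) ⟨hgood, hord⟩ hirr f hf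

/-- **AN-13 on class X9 from THEOREM B** (the form that needs no cite-only input once (V)/(L)(C) are
ported): `ConjSpanGenAll ⟹` some even branch of every X9 pair has `μ = 0`.
[cite: GreenbergLNM1716, §1 Conj. 1.11] [cite: MazurTateTeitelbaum1986Invent, §I.13] -/
theorem evenBranchMuZeroOnClassX9_of_conjSpanGenAll (hB : ConjSpanGenAllLevels.ConjSpanGenAll) :
    ∀ (W : WeierstrassCurve ℚ) [W.IsElliptic] [W.IsGloballyMinimal] (p : ℕ) [Fact p.Prime],
      ClassX9 W p →
      ∀ {N : ℕ} [NeZero N] (f : CuspForm (Gamma0 N) 2), IsNewformOf W f →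
        ∃ i < p - 1, Even i ∧
          ∃ k : ℕ, ‖PowerSeries.coeff k (padicLFunctionBranch f (unitRoot W p : ℚ_[p]) i)‖ = 1 := by
  intro W _ _ p _ hX9 N _ f hf
  obtain ⟨-, hp, hgood, hord, hirr, -⟩ := id hX9
  exact evenBranchMuZero_of_conjSpanGenAll hB W p (by omega) ⟨hgood, hord⟩ hirr f hf

end Summit.BirchSwinnertonDyer.BirchSwinnertonDyer.Rank1Residual.EvenBranch

end
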